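/-
HONEST FRAMING: certified error envelopes and provably optimal rounding/accumulation schemes for
low-precision formats under stated cost models; every table by two implementations; no hardware
or vendor claims.
-/
import Mathlib.Tactic.Linarith
import Mathlib.Tactic.NormNum
import Mathlib.Tactic.Ring
import Mathlib.Tactic.Push

/-!
# The demotion law (Theorem T8), part 5a: the eight candidate lines of a node (`Covers`)

Support for the LINE-FAMILY proof of OPTIMA T8(b)(iii) (the upper bound `D_t ≤ Q_t` of Conjecture D
for every tree with `M_t(u_q) ≤ 2`).  For a node `t = a·b` whose computed value `v` lies in the
binade `[σ, 2σ)`, the deficit of the node is bounded by one of eight affine functions of `v` built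
from the children's data (`μ = M - 1` and the child's active line `(α, λ)`):
`F1 = σ(α_a + u + u μ_b) + λ_a (v - σ)` (a keeps the budget, b is absorbed into the half-ulp), `F1m`
(the same with a's μ-line), `F2`, `F2m` (symmetric), `F3 = σ(u + μ_a + u λ_b) + α_b (v - σ)` (a sits at
the power of two `σ`, b receives the excess; available only when its slope is at most its intercept),
`F3m`, `F4`, `F4m` (symmetric).  `Covers … T` says that `T` is below one of the available lines; this
file proves its symmetry, monotonicity and the small convexity helpers used by the generated case
analysis (`OptDemotionNodeI/III/IIIs.lean`).
-/

namespace Summit.Ventures.CertifiedArithmetic.LowPrec.Opt.Demotion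

/-- `T` is covered by one of the (available) candidate lines of the node at scale `σ`, value `v`. -/
def Covers (u σ v Ma Aa La Mb Ab Lb T : ℚ) : Prop :=
  T ≤ (Aa + u + u * Mb) * σ + La * (v - σ) ∨ T ≤ (Ma + u + u * Mb) * σ ∨
  T ≤ (Ab + u + u * Ma) * σ + Lb * (v - σ) ∨ T ≤ (Mb + u + u * Ma) * σ ∨
  (Ab ≤ u + Ma + u * Lb ∧ T ≤ (u + Ma + u * Lb) * σ + Ab * (v - σ)) ∨
  (Mb ≤ u + Ma ∧ T ≤ (u + Ma) * σ + Mb * (v - σ)) ∨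
  (Aa ≤ u + Mb + u * La ∧ T ≤ (u + Mb + u * La) * σ + Aa * (v - σ)) ∨
  (Ma ≤ u + Mb ∧ T ≤ (u + Mb) * σ + Ma * (v - σ))

namespace Covers

variable {u σ v Ma Aa La Mb Ab Lb T : ℚ}

/-- Line F1 covers. -/
theorem F1 (h : T ≤ (Aa + u + u * Mb) * σ + La * (v - σ)) : Covers u σ v Ma Aa La Mb Ab Lb T :=
  Or.inl h
/-- Line F1m covers. -/
theorem F1m (h : T ≤ (Ma + u + u * Mb) * σ) : Covers u σ v Ma Aa La Mb Ab Lb T := Or.inr (Or.inl h)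
/-- Line F2 covers. -/
theorem F2 (h : T ≤ (Ab + u + u * Ma) * σ + Lb * (v - σ)) : Covers u σ v Ma Aa La Mb Ab Lb T :=
  Or.inr (Or.inr (Or.inl h))
/-- Line F2m covers. -/
theorem F2m (h : T ≤ (Mb + u + u * Ma) * σ) : Covers u σ v Ma Aa La Mb Ab Lb T :=
  Or.inr (Or.inr (Or.inr (Or.inl h)))
/-- Line F3 covers (available when its slope is at most its intercept). -/
theorem F3 (hg : Ab ≤ u + Ma + u * Lb) (h : T ≤ (u + Ma + u * Lb) * σ + Ab * (v - σ)) :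
    Covers u σ v Ma Aa La Mb Ab Lb T := Or.inr (Or.inr (Or.inr (Or.inr (Or.inl ⟨hg, h⟩))))
/-- Line F3m covers. -/
theorem F3m (hg : Mb ≤ u + Ma) (h : T ≤ (u + Ma) * σ + Mb * (v - σ)) :
    Covers u σ v Ma Aa La Mb Ab Lb T := Or.inr (Or.inr (Or.inr (Or.inr (Or.inr (Or.inl ⟨hg, h⟩)))))
/-- Line F4 covers. -/
theorem F4 (hg : Aa ≤ u + Mb + u * La) (h : T ≤ (u + Mb + u * La) * σ + Aa * (v - σ)) :
    Covers u σ v Ma Aa La Mb Ab Lb T :=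
  Or.inr (Or.inr (Or.inr (Or.inr (Or.inr (Or.inr (Or.inl ⟨hg, h⟩))))))
/-- Line F4m covers. -/
theorem F4m (hg : Ma ≤ u + Mb) (h : T ≤ (u + Mb) * σ + Ma * (v - σ)) :
    Covers u σ v Ma Aa La Mb Ab Lb T :=
  Or.inr (Or.inr (Or.inr (Or.inr (Or.inr (Or.inr (Or.inr ⟨hg, h⟩))))))

/-- Swapping the two children permutes the eight lines. -/
theorem swap (h : Covers u σ v Mb Ab Lb Ma Aa La T) : Covers u σ v Ma Aa La Mb Ab Lb T := by
  rcases h with h | h | h | h | ⟨g, h⟩ | ⟨g, h⟩ | ⟨g, h⟩ | ⟨g, h⟩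
  · exact F2 h
  · exact F2m h
  · exact F1 h
  · exact F1m h
  · exact F4 g h
  · exact F4m g h
  · exact F3 g h
  · exact F3m g h

/-- `Covers` is downward closed in `T`. -/
theorem mono {T' : ℚ} (hT : T' ≤ T) (h : Covers u σ v Ma Aa La Mb Ab Lb T) :
    Covers u σ v Ma Aa La Mb Ab Lb T' := by
  rcases h with h | h | h | h | ⟨g, h⟩ | ⟨g, h⟩ | ⟨g, h⟩ | ⟨g, h⟩
  · exact F1 (hT.trans h)
  · exact F1m (hT.trans h)
  · exact F2 (hT.trans h)
  · exact F2m (hT.trans h)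
  · exact F3 g (hT.trans h)
  · exact F3m g (hT.trans h)
  · exact F4 g (hT.trans h)
  · exact F4m g (hT.trans h)

/-- EXPORT: whichever line covers, `T ≤ σ·α + λ·(v - σ)` for an admissible pair `(α, λ)` of the four
transforms; packaged as an eliminator into any goal. -/
theorem elim {P : Prop} (h : Covers u σ v Ma Aa La Mb Ab Lb T)
    (h1 : T ≤ (Aa + u + u * Mb) * σ + La * (v - σ) → P)
    (h1m : T ≤ (Ma + u + u * Mb) * σ → P)
    (h2 : T ≤ (Ab + u + u * Ma) * σ + Lb * (v - σ) → P)
    (h2m : T ≤ (Mb + u + u * Ma) * σ → P)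
    (h3 : Ab ≤ u + Ma + u * Lb → T ≤ (u + Ma + u * Lb) * σ + Ab * (v - σ) → P)
    (h3m : Mb ≤ u + Ma → T ≤ (u + Ma) * σ + Mb * (v - σ) → P)
    (h4 : Aa ≤ u + Mb + u * La → T ≤ (u + Mb + u * La) * σ + Aa * (v - σ) → P)
    (h4m : Ma ≤ u + Mb → T ≤ (u + Mb) * σ + Ma * (v - σ) → P) : P := by
  rcases h with h | h | h | h | ⟨g, h⟩ | ⟨g, h⟩ | ⟨g, h⟩ | ⟨g, h⟩
  · exact h1 h
  · exact h1m h
  · exact h2 h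
  · exact h2m h
  · exact h3 g h
  · exact h3m g h
  · exact h4 g h
  · exact h4m g h

end Covers

/-- A point below a convex combination of two numbers is below one of them. -/
theorem cover_two {T A B w : ℚ} (hw0 : 0 ≤ w) (hw1 : w ≤ 1) (h : T ≤ w * A + (1 - w) * B) :
    T ≤ A ∨ T ≤ B := by
  rcases le_total A B with hAB | hAB
  · right; nlinarith [mul_le_mul_of_nonneg_left hAB hw0]
  · left; nlinarith [mul_le_mul_of_nonneg_left hAB (sub_nonneg.2 hw1)]

/-- A point below a convex combination of three numbers is below one of them. -/
theorem cover_three {T A B C w1 w2 : ℚ} (h1 : 0 ≤ w1) (h2 : 0 ≤ w2) (h12 : w1 + w2 ≤ 1)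
    (h : T ≤ w1 * A + w2 * B + (1 - w1 - w2) * C) : T ≤ A ∨ T ≤ B ∨ T ≤ C := by
  rcases le_total A C with hAC | hAC
  · rcases le_total B C with hBC | hBC
    · right; right
      nlinarith [mul_le_mul_of_nonneg_left hAC h1, mul_le_mul_of_nonneg_left hBC h2]
    · rcases le_total A B with hAB | hAB
      · right; left
        nlinarith [mul_le_mul_of_nonneg_left hAB h1,
          mul_le_mul_of_nonneg_left hBC (by linarith : (0:ℚ) ≤ 1 - w1 - w2)]
      · left
        nlinarith [mul_le_mul_of_nonneg_left hAB h2,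
          mul_le_mul_of_nonneg_left (hBC.trans hAB) (by linarith : (0:ℚ) ≤ 1 - w1 - w2)]
  · rcases le_total A B with hAB | hAB
    · right; left
      nlinarith [mul_le_mul_of_nonneg_left hAB h1,
        mul_le_mul_of_nonneg_left (hAC.trans hAB) (by linarith : (0:ℚ) ≤ 1 - w1 - w2)]
    · left
      nlinarith [mul_le_mul_of_nonneg_left hAB h2,
        mul_le_mul_of_nonneg_left hAC (by linarith : (0:ℚ) ≤ 1 - w1 - w2)]

end Summit.Ventures.CertifiedArithmetic.LowPrec.Opt.Demotion
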